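import Mathlib
import Summits.Ventures.HodgeRepro2.Tier7.Line3.AdicCompletionRestriction

/-!
# Tier7/Line3/AdicCompletionRestrictionDegree — one prime above `v` ⇒ the local degree is `[E : K]`; the root is `‖·‖^(1/2)`
(seat t7-x1, gen 4; the (E)-discharge's `|·|_{w̃}^{1/2}` made literal)

LINE 3 (t7-plan-3), version (ii). AdicCompletionRestriction's κ-side absolute value is `abvRoot v wE = ‖·‖ ^ (1/(e f))`
with `localDeg v wE = e · f`. By the fundamental identity `∑_{P | v} e_P f_P = [E : K]` (`Ideal.sum_ramification_inertia`),
when `v` has exactly ONE prime `wE` above it (the dictionary's INERT `v₁`, or a ramified place) the local degree is the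
global degree: `localDeg_eq_finrank`. For the quadratic CM extension (`finrank K E = 2`) this gives `rootExp v wE = 1/2`
(`rootExp_eq_half`) and `abvRoot v wE y = ‖y‖ ^ (1/2) = √‖y‖` (`abvRoot_eq_sqrt`) — exactly the (E)-discharge's
«`abv = |·|_{w̃}^{1/2}`» (proofs/t7/L3/X1-RESIDUAL-TYPED.md), now a theorem about Mathlib's completion. Both arithmetic
facts are DISPLAYED binders (crit-2 STATUS l. 15935 (3)): `hone : (primesOver v.asIdeal (𝓞 E)).ncard = 1` («one prime of
`E` above `v₁`») and `hdeg : Module.finrank K E = 2` («`E/E⁺` quadratic») — neither is a theorem of this file, both are the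
datum's arithmetic at the identification; `√‖y‖` is `Real.sqrt` of Mathlib's NORMALISED norm on `wE.adicCompletion E`
(`‖y‖ = N(wE)^(−v(y))`, the norm p703140 / p705534 read). DICTIONARY (in words):
`K = E⁺`, `E` the CM field ([E : E⁺] = 2), `v = v₁` inert, `wE` the place above it. Nothing here is about (N), (P), the real
`X`, or HC_CM; §8(d): NO. Blind lane: Mathlib + the HodgeRepro2 prefix; no sorry; axioms ⊆ {propext, Classical.choice,
Quot.sound}.
-/

namespace Summit.Ventures.HodgeRepro2.Tier7.Line3.AdicCompletionRestriction

open IsDedekindDomain IsDedekindDomain.HeightOneSpectrum NumberField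
open scoped NumberField

variable {K E : Type*} [Field K] [NumberField K] [Field E] [NumberField E] [Algebra K E]
  (v : HeightOneSpectrum (𝓞 K)) (wE : HeightOneSpectrum (𝓞 E)) [wE.asIdeal.LiesOver v.asIdeal]

omit [NumberField K] [NumberField E] in
/-- `wE.asIdeal` lies in `primesOver v.asIdeal (𝓞 E)`. -/
theorem asIdeal_mem_primesOver : wE.asIdeal ∈ Ideal.primesOver v.asIdeal (𝓞 E) :=
  ⟨wE.isPrime, inferInstance⟩

omit [NumberField K] [NumberField E] in
/-- with exactly one prime above `v`, the set of primes above `v` is `{wE.asIdeal}`. -/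
theorem primesOver_eq_singleton (h : (Ideal.primesOver v.asIdeal (𝓞 E)).ncard = 1) :
    Ideal.primesOver v.asIdeal (𝓞 E) = {wE.asIdeal} := by
  obtain ⟨P, hP⟩ := Set.ncard_eq_one.1 h
  have hmem := asIdeal_mem_primesOver v wE
  rw [hP, Set.mem_singleton_iff] at hmem
  rw [hP, hmem]

/-- **the fundamental identity with one prime above `v`: `e · f = [E : K]`.** -/
theorem localDeg_eq_finrank (h : (Ideal.primesOver v.asIdeal (𝓞 E)).ncard = 1) :
    localDeg v wE = Module.finrank K E := by
  have hsum := Ideal.sum_ramification_inertia (𝓞 E) K E (p := v.asIdeal) v.ne_bot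
  have hfin : IsDedekindDomain.primesOverFinset v.asIdeal (𝓞 E) = {wE.asIdeal} := by
    rw [← Finset.coe_eq_singleton, IsDedekindDomain.coe_primesOverFinset v.ne_bot, primesOver_eq_singleton v wE h]
  rw [hfin, Finset.sum_singleton, Ideal.inertiaDeg'_eq_inertiaDeg] at hsum
  exact hsum

/-- with one prime above `v` in a quadratic extension, the root exponent is `1/2`. -/
theorem rootExp_eq_half (h : (Ideal.primesOver v.asIdeal (𝓞 E)).ncard = 1) (hdeg : Module.finrank K E = 2) :
    rootExp v wE = 1 / 2 := by
  rw [rootExp, localDeg_eq_finrank v wE h, hdeg]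
  norm_num

/-- **the κ-side absolute value is the square root of Mathlib's norm** (one prime above `v`, `[E : K] = 2`). -/
theorem abvRoot_eq_sqrt (h : (Ideal.primesOver v.asIdeal (𝓞 E)).ncard = 1) (hdeg : Module.finrank K E = 2)
    (y : wE.adicCompletion E) : abvRoot v wE y = Real.sqrt ‖y‖ := by
  rw [abvRoot_apply, rootExp_eq_half v wE h hdeg, Real.sqrt_eq_rpow]

end Summit.Ventures.HodgeRepro2.Tier7.Line3.AdicCompletionRestriction
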